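/-
Origin: expansion seat `planner-pub-hodgecm-pv07-g2-0`, handover #5 2026-08-18T06:25:10Z (`HOME/pub-hodgecm-pv07-g2/lean/Pv07g2/SmokeDilation.lean`, md5 a389a34e, 129 lines);
landed by the gen-7 packager in gate run 25 as `HodgeCM/PerL34/LocalFactors/SmokeDilation.lean` (import ^import Pv07g2\.→import HodgeCM.PerL34.LocalFactors. ×1).
-/
/-
Copyright: HodgeCM publication cell (pub-hodgecm), DAG node N31f/N31g — split places in the D4 dilation model
(prover lineage pv07, gen 2).  Released under the package licence.

# NON-VACUITY of the dilation-model datum at the intended objects: `F = ℚ_p`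

`DilationModel.splitIntegrand μV x₀ r μG ν χ'` (landed run 24) is a CONSTRUCTED `LocalIntegrand`
(`G = Fˣ`, `Sp = L²(F³)`, `ω = dilationRep`, `φ = 1_D`), and `hasSplitModel_splitIntegrand`,
`splitIntegrand_I_pos` (tex l. 622–623, `v ∈ S` split) and `splitIntegrand_f_eqOn_shell_resIndex`
(tex l. 629–630, `v ∉ S` split) are theorems about it under instance binders and side conditions.
This file certifies that those binders and side conditions are JOINTLY INHABITED by the objects the tex
means: `F = ℚ_p` (Mathlib's `Padic`: a non-trivially normed, ultrametric, proper field), an additive Haar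
measure on `ℚ_p³` normalised by `vol(ℤ_p³) = 1` (`Measure.addHaarMeasure` on the compact open unit box), a
multiplicative Haar measure `d^×y` on `ℚ_pˣ` (`Measure.haarMeasure` on the compact open subgroup `U₁`),
`ϖ = p` (`‖p‖_p = p⁻¹ < 1`), `x₀ = (1,1,1)`, `r = ‖p‖`, `ν = χ' = 1`:
* `padic_smoke_ram` — `HasSplitModel` holds and `0 < I_v(1_D)` for the constructed datum at `ℚ_p`;
* `padic_smoke_unram` — on the shell `‖y‖_p = p^{-k}` the unramified integrand IS `(tOf [ℤ_p : pℤ_p])^{|k|}`.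
The σ-algebra binders `[MeasurableSpace ℚ_[p]] [BorelSpace ℚ_[p]]` are inhabited (`borel_padic_exists'`).
Nothing here is an input of the package.  Unit `pub-hodgecm-pv07-g2`, 2026-08-18.
-/
import Summits.HodgeConjecture.HodgeCM.PerL34.LocalFactors.DilationResIndex
import Mathlib.NumberTheory.Padics.ProperSpace

/-! PORT of `HodgeCM/PerL34/LocalFactors/SmokeDilation.lean` (HodgeCMPerL run 82) — verbatim mechanical port; provenance in the PORT header line. -/

set_option autoImplicit false

noncomputable section

open MeasureTheory MeasureTheory.Measure Set Metric TopologicalSpace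
open scoped NNReal ENNReal Pointwise

namespace HodgeCM
namespace PerL34
namespace LocalFactors
namespace DilationModel
namespace Smoke

/-- the σ-algebra binders below are inhabited: the Borel σ-algebra on `ℚ_p` -/
theorem borel_padic_exists' (p : ℕ) [Fact p.Prime] :
    ∃ m : MeasurableSpace ℚ_[p], @BorelSpace ℚ_[p] _ m :=
  ⟨borel _, @BorelSpace.mk ℚ_[p] _ (borel _) rfl⟩

variable (p : ℕ) [hp : Fact p.Prime]

/-- (Ported verbatim from the HodgeCMPerL package; no docstring in the source.) -/
theorem norm_p_pos' : 0 < ‖(p : ℚ_[p])‖ := by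
  rw [Padic.norm_p]; have : (0 : ℝ) < p := by exact_mod_cast hp.out.pos
  positivity

/-- (Ported verbatim from the HodgeCMPerL package; no docstring in the source.) -/
theorem norm_p_lt_one' : ‖(p : ℚ_[p])‖ < 1 := by
  rw [Padic.norm_p]; exact inv_lt_one_of_one_lt₀ (by exact_mod_cast hp.out.one_lt)

/-- (Ported verbatim from the HodgeCMPerL package; no docstring in the source.) -/
theorem p_ne_zero' : (p : ℚ_[p]) ≠ 0 := norm_pos_iff.mp (norm_p_pos' p)

/-- `ϖ = p` as a unit of `ℚ_p` -/
def varpi : ℚ_[p]ˣ := Units.mk0 (p : ℚ_[p]) (p_ne_zero' p)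

/-- (Ported verbatim from the HodgeCMPerL package; no docstring in the source.) -/
@[simp] theorem varpi_val : ((varpi p : ℚ_[p]ˣ) : ℚ_[p]) = p := rfl

/-- (Ported verbatim from the HodgeCMPerL package; no docstring in the source.) -/
theorem norm_varpi_lt_one : ‖((varpi p : ℚ_[p]ˣ) : ℚ_[p])‖ < 1 := norm_p_lt_one' p

/-- `‖(1,1,1)‖ = 1` in `ℚ_p³` (sup norm) -/
theorem norm_one_box : ‖(1 : Fin 3 → ℚ_[p])‖ = 1 := norm_one

/-- the unit box `ℤ_p³ = closedBall 0 1 ⊂ ℚ_p³`: compact with non-empty interior (it is open) -/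
def unitBox : PositiveCompacts (Fin 3 → ℚ_[p]) where
  carrier := closedBall (0 : Fin 3 → ℚ_[p]) 1
  isCompact' := isCompact_closedBall _ _
  interior_nonempty' := by
    rw [(IsUltrametricDist.isOpen_closedBall (0 : Fin 3 → ℚ_[p]) one_ne_zero).interior_eq]
    exact ⟨0, mem_closedBall_self zero_le_one⟩

attribute [local instance] unitsBorel borelSpace_units

/-- `U₁ = {y : ‖(y-1)·x₀‖ ≤ r} ⊂ ℚ_pˣ` for `x₀ = (1,1,1)`, `r = ‖p‖`: compact with non-empty interior -/
def U1Compacts : PositiveCompacts ℚ_[p]ˣ where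
  carrier := (Units.val : ℚ_[p]ˣ → ℚ_[p]) ⁻¹' U1 (1 : Fin 3 → ℚ_[p]) ‖(p : ℚ_[p])‖
  isCompact' := isCompact_val_preimage_U1 (by rw [norm_one_box]; exact norm_p_lt_one' p) (norm_p_pos' p)
  interior_nonempty' := by
    have ho : IsOpen ((Units.val : ℚ_[p]ˣ → ℚ_[p]) ⁻¹' U1 (1 : Fin 3 → ℚ_[p]) ‖(p : ℚ_[p])‖) :=
      (isOpen_U1 (norm_p_pos' p)).preimage (Units.continuous_val : Continuous (Units.val : ℚ_[p]ˣ → ℚ_[p]))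
    change (interior ((Units.val : ℚ_[p]ˣ → ℚ_[p]) ⁻¹' U1 (1 : Fin 3 → ℚ_[p]) ‖(p : ℚ_[p])‖)).Nonempty
    rw [ho.interior_eq]
    exact ⟨1, show ((1 : ℚ_[p]ˣ) : ℚ_[p]) ∈ U1 (1 : Fin 3 → ℚ_[p]) ‖(p : ℚ_[p])‖ by
      rw [Units.val_one]; exact one_mem_U1 (norm_p_pos' p).le⟩

/-- a multiplicative Haar measure `d^×y` on `ℚ_pˣ` (normalised on `U₁`) -/
def muG : Measure ℚ_[p]ˣ := haarMeasure (U1Compacts p)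

/-- (Ported verbatim from the HodgeCMPerL package; no docstring in the source.) -/
instance : (muG p).IsHaarMeasure := by unfold muG; infer_instance
/-- (Ported verbatim from the HodgeCMPerL package; no docstring in the source.) -/
instance : (muG p).Regular := by unfold muG; infer_instance

variable [MeasurableSpace ℚ_[p]] [BorelSpace ℚ_[p]]

/-- the additive Haar measure on `ℚ_p³` with `vol(ℤ_p³) = 1` -/
def muV : Measure (Fin 3 → ℚ_[p]) := addHaarMeasure (unitBox p)

/-- (Ported verbatim from the HodgeCMPerL package; no docstring in the source.) -/
instance : (muV p).IsAddHaarMeasure := by unfold muV; infer_instance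

/-- (Ported verbatim from the HodgeCMPerL package; no docstring in the source.) -/
theorem muV_real_unitBox : (muV p).real (closedBall (0 : Fin 3 → ℚ_[p]) 1) = 1 := by
  rw [measureReal_def, muV, show closedBall (0 : Fin 3 → ℚ_[p]) 1 = (unitBox p : Set (Fin 3 → ℚ_[p])) from rfl,
    addHaarMeasure_self, ENNReal.toReal_one]

/-- **Smoke, `v ∈ S` split (tex l. 617–623).**  For `F = ℚ_p`, `D = closedBall (1,1,1) ‖p‖ = (1,1,1) + pℤ_p³`,
`ν = χ' = 1`: the constructed datum HAS a split model and its local factor is positive. -/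
theorem padic_smoke_ram :
    HasSplitModel (splitIntegrand (muV p) (1 : Fin 3 → ℚ_[p]) ‖(p : ℚ_[p])‖ (muG p) 1 1) ∧
      0 < (splitIntegrand (muV p) (1 : Fin 3 → ℚ_[p]) ‖(p : ℚ_[p])‖ (muG p) 1 1).I := by
  have hr : ‖(p : ℚ_[p])‖ < ‖(1 : Fin 3 → ℚ_[p])‖ := by rw [norm_one_box]; exact norm_p_lt_one' p
  exact ⟨hasSplitModel_splitIntegrand (muV p) 1 _ (muG p) 1 1 hr (norm_p_pos' p) (fun _ _ => rfl) (fun _ _ => rfl),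
    splitIntegrand_I_pos (muV p) 1 _ (muG p) 1 1 hr (norm_p_pos' p) (fun _ _ => rfl) (fun _ _ => rfl)⟩

/-- **Smoke, `v ∉ S` split (tex l. 629–630).**  For `F = ℚ_p`, `φ⁰ = 1_{ℤ_p³}` (`vol ℤ_p³ = 1`), `ν = χ' = 1`,
`ϖ = p`: on the shell `‖y‖_p = ‖p‖ᵏ = p^{-k}` the integrand of the constructed datum is the constant
`(tOf q)^{|k|} = q^{-3|k|/2}` with `q = [ℤ_p : pℤ_p]` (`LocalModulus.resIndex`), and `2 ≤ q`. -/
theorem padic_smoke_unram (k : ℤ) :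
    EqOn (splitIntegrand (muV p) 0 1 (muG p) 1 1).f
      (fun _ => ((EulerProduct.tOf (LocalModulus.resIndex (varpi p)) : ℝ) : ℂ) ^ k.natAbs)
      (shell (varpi p) k) ∧ 2 ≤ LocalModulus.resIndex (varpi p) := by
  refine ⟨fun y hy => ?_, two_le_resIndex_of_norm_lt_one _ (norm_varpi_lt_one p)⟩
  rw [splitIntegrand_f_eqOn_shell_resIndex (muV p) 1 1 (muG p) 1 (varpi p) (norm_varpi_lt_one p)
    (fun _ _ => rfl) (fun _ _ => rfl) (muV_real_unitBox p) k hy]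
  simp

end Smoke
end DilationModel
end LocalFactors
end PerL34
end HodgeCM

end
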